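import Mathlib.Data.Rat.Defs
import Mathlib.Data.Rat.Floor
import Mathlib.Tactic.Linarith
import Mathlib.Tactic.NormNum
import Mathlib.Tactic.FieldSimp
import Mathlib.Tactic.Ring
import Mathlib.Tactic.IntervalCases
import HarnessLib

/-!
# Volkov 2020 (NPB 961, 115232) §2.1: the QED ultraviolet degree of divergence ω(s) = 2·Loop(s) − |s| + ½|Lept(s)| in HALF-EDGE form — «for connected sets s it equals 2 − ¾N_lepton − ½N_photon» — as a kernel identity on the vertex / line / leg counts, with its consequences (N_lepton is even; the I-closure shift; the four UV-divergent leg signatures)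

independent recomputation; certified where stated, statistical where stated; no new-physics claim.

CITATION HEADER (venture `QEDPrecision`, cell `pub-qed`, track TROPICAL seat V3b = `pub-qed-trop-v3-lit-2` gen 6; VALUE-FREE: combinatorics of the
printed definition only — no integral, no graph of the cell, nothing per word). First kernel item for [Volkov2020]; companion of
`Volkov2017.SamplingDegree` (computable ω on an explicit graph model, `Gr.omega`) — here ω is treated ABSTRACTLY through the counts that any
QED (sub)graph determines, so the identity is available to every model that supplies the two half-edge relations.

Sources.
* [Volkov2020] S. Volkov, "Infrared and ultraviolet power counting on the mass shell in quantum electrodynamics", Nucl. Phys. B 961 (2020)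
  115232 = arXiv:1912.04885v4, §2.1 (journal p.7; e-print tex `iclos_arxiv.tex` l.159–163, held by the cell under
  `pub-qed-trop-v3-lit-2/sources/arxiv-1912.04885/`), VERBATIM: "The ultraviolet degree of divergence is defined as
  ω(s) = 2·Loop(s) − |s| + ½|Lept(s)|. For connected sets s it equals 2 − ¾N_lepton − ½N_photon, where N_lepton, N_photon are the numbers of
  external lepton and photon lines in regard to s." (Loop(s) = "the minimum of |s ∖ T|, where T runs over all 1-trees of G" = the cyclomatic
  number of s); §3.2, proof of Lemma 3.5 (journal p.13; tex l.425–428): "ω(IClos(s)) = ω(s) + 2(Loop(IClos(s)) − Loop(s)) − |IClos(s) ∖ s| =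
  ω(s) + |IClos(s) ∖ s| (because the I-closure does not change the number of connectivity components of the set)"; §3.2 fn 24 (journal p.14):
  a lepton self-energy subgraph has "ω(IClos(h_j)) = 1/2 > 0".
* [Volkov2024] S. Volkov, Phys. Rev. D 110, 036001 (2024) = arXiv:2404.00649v2, §III p.8 (the same ω, and the list of UV-divergent subgraph
  types): "lepton self-energy subgraphs (N_l = 2, N_γ = 0), vertexlike subgraphs (N_l = 2, N_γ = 1), photon self-energy subgraphs (N_l = 0,
  N_γ = 2), photon-photon scattering subgraphs (N_l = 0, N_γ = 4)" with fn 2 "since odd lepton loops are forbidden …"; §IV.B.2 p.10–11: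
  "ω_G(s) = 2 × Loop(s) − |s| + ½|Lept(s)|".

The model. A (sub)graph s of a QED Feynman graph is summarised by six natural numbers: `V` = vertices incident to s, `El` / `Eg` = lepton /
photon lines of s, `Nl` / `Ng` = lepton / photon HALF-EDGES at those vertices that are NOT lines of s ("external lines in regard to s":
external legs of G and lines of G outside s alike), `c` = connected components of s. Every QED vertex carries exactly two lepton half-edges
and one photon half-edge, which is the content of the two HANDSHAKE relations `2·V = 2·El + Nl` and `V = 2·Eg + Ng`; the cyclomatic number is
`Loop = El + Eg − V + c`. Under these relations the printed ω is a function of (Nl, Ng, c) alone. What is deliberately NOT here: any graph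
data structure (see `Volkov2017.SamplingDegree.Gr`), I-closures as sets, 1-trees, or anything about integrals.

What the kernel certifies (ring arithmetic over ℚ on the printed definition; `omega` cases by `interval_cases`/`norm_num`):
* `QEDCounts`, `QEDCounts.loops`, `QEDCounts.omega` — the printed definition ω = 2·Loop − |s| + ½|Lept(s)| on the count model;
* `omega_eq_legs` — ω = 2c − ¾Nl − ½Ng (the printed "connected" formula is the case c = 1, `omega_connected`);
* `Nl_even` — the number of external lepton legs of any s is even (from 2V = 2El + Nl);
* `omega_add_internal_photons` — adding k photon lines whose endpoints are already vertices of s and which do not change the number of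
  components raises ω by exactly k: the printed I-closure identity ω(IClos(s)) = ω(s) + |IClos(s) ∖ s|;
* `omega_self_energy`, `omega_vertex`, `omega_photon_self_energy`, `omega_light_by_light`, `omega_single_photon_line` — the printed values
  ½, 0, 1, 0 for the four UV-divergent signatures and −1 for a lone photon line (Nl = 4, Ng = 0);
* `omega_nonneg_iff_connected` — for connected s: ω ≥ 0 ⇔ 3·Nl + 2·Ng ≤ 8, i.e. (with Nl even) exactly the signatures (Nl, Ng) ∈
  {(0,0…4), (2,0), (2,1)} — the printed four types plus the photon-odd / vacuum signatures that Furry's theorem and the absence of tadpoles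
  remove in QED (fn 2 of [Volkov2024]); in particular `omega_neg_of_four_leptons`: Nl ≥ 4 ⇒ ω < 0 (no UV-divergent subgraph has four or
  more external lepton legs), and `omega_two_leptons`: Nl = 2 ⇒ (ω ≥ 0 ⇔ Ng ≤ 1) — self-energy or vertexlike, nothing else.
-/

namespace Literature.MathematicalPhysics.QuantumFieldTheory.Volkov2020

/-- The count summary of a set s of internal lines of a QED graph: vertices incident to s, lepton / photon lines in s, lepton / photon
half-edges at those vertices not belonging to s ("external lines in regard to s"), connected components of s; with the two QED HANDSHAKE
relations (every vertex: two lepton half-edges, one photon half-edge) and V ≥ c (every component has a vertex; we allow the degenerate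
bookkeeping V = c = 0 only through the relations). [cite: Volkov2020, §2.1 (journal p.7)] -/
structure QEDCounts where
  /-- number of vertices incident to s -/
  V : ℕ
  /-- lepton lines in s -/
  El : ℕ
  /-- photon lines in s -/
  Eg : ℕ
  /-- external lepton half-edges in regard to s -/
  Nl : ℕ
  /-- external photon half-edges in regard to s -/
  Ng : ℕ
  /-- connected components of s -/
  c : ℕ
  /-- lepton handshake: each vertex has exactly two lepton half-edges -/
  hand_l : 2 * V = 2 * El + Nl
  /-- photon handshake: each vertex has exactly one photon half-edge -/
  hand_g : V = 2 * Eg + Ng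
  /-- a forest on V vertices with c components has V − c edges, so a graph has at least that many: cyclomatic number ≥ 0 -/
  loops_nonneg : V ≤ El + Eg + c

namespace QEDCounts

variable (s : QEDCounts)

/-- "Loop(s) … the minimum of |s ∖ T|, where T runs over all 1-trees" = the cyclomatic number |s| − V + c (as a rational number).
[cite: Volkov2020, §2.1 (journal p.7)] -/
def loops : ℚ := (s.El : ℚ) + s.Eg - s.V + s.c

/-- "The ultraviolet degree of divergence is defined as ω(s) = 2·Loop(s) − |s| + ½|Lept(s)|." [cite: Volkov2020, §2.1 (journal p.7; tex l.159–161)] -/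
def omega : ℚ := 2 * s.loops - ((s.El : ℚ) + s.Eg) + (s.El : ℚ) / 2

/-- The cyclomatic number is a natural number (≥ 0) under `loops_nonneg`. [cite: Volkov2020, §2.1] -/
theorem loops_nonneg' : 0 ≤ s.loops := by
  unfold loops
  have h := s.loops_nonneg
  have : (s.V : ℚ) ≤ (s.El : ℚ) + s.Eg + s.c := by exact_mod_cast h
  linarith

/-- THE HALF-EDGE FORM: ω(s) = 2c − ¾N_lepton − ½N_photon for every line set s (c = its number of components).
[cite: Volkov2020, §2.1 (journal p.7; tex l.163)] -/
theorem omega_eq_legs : s.omega = 2 * (s.c : ℚ) - (3 / 4) * s.Nl - (1 / 2) * s.Ng := by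
  have hl : (2 : ℚ) * s.V = 2 * s.El + s.Nl := by exact_mod_cast s.hand_l
  have hg : (s.V : ℚ) = 2 * s.Eg + s.Ng := by exact_mod_cast s.hand_g
  unfold omega loops
  linarith

/-- "For connected sets s it equals 2 − ¾N_lepton − ½N_photon." [cite: Volkov2020, §2.1 (journal p.7; tex l.163)] -/
theorem omega_connected (hc : s.c = 1) : s.omega = 2 - (3 / 4) * (s.Nl : ℚ) - (1 / 2) * s.Ng := by
  rw [omega_eq_legs, hc]; push_cast; ring

/-- The number of external lepton legs of any line set is EVEN (lepton-number bookkeeping: 2V = 2El + Nl). [cite: Volkov2020, §2.1] -/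
theorem Nl_even : 2 ∣ s.Nl := by
  refine ⟨s.V - s.El, ?_⟩
  have h := s.hand_l
  omega

end QEDCounts

/-! ## The I-closure shift -/

/-- Adding `k` photon lines to s whose endpoints are already vertices of s and which join vertices already connected inside s (so V, El, c and
the lepton legs are unchanged, Eg grows by k and the photon legs drop by 2k) raises ω by exactly k: the printed identity
"ω(IClos(s)) = ω(s) + 2(Loop(IClos(s)) − Loop(s)) − |IClos(s) ∖ s| = ω(s) + |IClos(s) ∖ s| (because the I-closure does not change the number
of connectivity components of the set)". [cite: Volkov2020, §3.2, proof of Lemma 3.5 (journal p.13; tex l.425–428)] -/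
theorem omega_add_internal_photons (s t : QEDCounts) (k : ℕ)
    (hV : t.V = s.V) (hEl : t.El = s.El) (hEg : t.Eg = s.Eg + k) (hc : t.c = s.c) :
    t.omega = s.omega + k := by
  have hs := s.omega_eq_legs
  have ht := t.omega_eq_legs
  -- the photon legs of t are those of s minus the 2k half-edges now internal
  have hgs : (s.V : ℚ) = 2 * s.Eg + s.Ng := by exact_mod_cast s.hand_g
  have hgt : (t.V : ℚ) = 2 * t.Eg + t.Ng := by exact_mod_cast t.hand_g
  have hls : (2 : ℚ) * s.V = 2 * s.El + s.Nl := by exact_mod_cast s.hand_l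
  have hlt : (2 : ℚ) * t.V = 2 * t.El + t.Nl := by exact_mod_cast t.hand_l
  have hV' : (t.V : ℚ) = s.V := by exact_mod_cast hV
  have hEl' : (t.El : ℚ) = s.El := by exact_mod_cast hEl
  have hEg' : (t.Eg : ℚ) = s.Eg + k := by exact_mod_cast hEg
  have hc' : (t.c : ℚ) = s.c := by exact_mod_cast hc
  rw [ht, hs]
  have hNl : (t.Nl : ℚ) = s.Nl := by linarith
  have hNg : (t.Ng : ℚ) = s.Ng - 2 * k := by linarith
  rw [hNl, hNg, hc']
  ring

/-! ## The printed values on the UV-divergent signatures -/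

namespace QEDCounts

variable (s : QEDCounts)

/-- Lepton self-energy subgraph (connected, N_l = 2, N_γ = 0): ω = ½ — "ω(IClos(h_j)) = 1/2 > 0" of [Volkov2020] fn 24; the signature list is
[Volkov2024] §III p.8. [cite: Volkov2020, §3.2 fn 24 (journal p.14)] -/
theorem omega_self_energy (hc : s.c = 1) (hl : s.Nl = 2) (hg : s.Ng = 0) : s.omega = 1 / 2 := by
  rw [s.omega_connected hc, hl, hg]; norm_num

/-- Vertexlike subgraph (connected, N_l = 2, N_γ = 1): ω = 0 (logarithmic). [cite: Volkov2020, §2.1 (journal p.7)] -/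
theorem omega_vertex (hc : s.c = 1) (hl : s.Nl = 2) (hg : s.Ng = 1) : s.omega = 0 := by
  rw [s.omega_connected hc, hl, hg]; norm_num

/-- Photon self-energy subgraph (connected, N_l = 0, N_γ = 2): ω = 1. [cite: Volkov2020, §2.1 (journal p.7)] -/
theorem omega_photon_self_energy (hc : s.c = 1) (hl : s.Nl = 0) (hg : s.Ng = 2) : s.omega = 1 := by
  rw [s.omega_connected hc, hl, hg]; norm_num

/-- Photon-photon scattering subgraph (connected, N_l = 0, N_γ = 4): ω = 0. [cite: Volkov2020, §2.1 (journal p.7)] -/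
theorem omega_light_by_light (hc : s.c = 1) (hl : s.Nl = 0) (hg : s.Ng = 4) : s.omega = 0 := by
  rw [s.omega_connected hc, hl, hg]; norm_num

/-- A lone photon line (connected, N_l = 4 — two lepton half-edges at each endpoint — and N_γ = 0): ω = −1, as the definition gives directly
(Loop = 0, |s| = 1, no lepton line). [cite: Volkov2020, §2.1 (journal p.7)] -/
theorem omega_single_photon_line (hc : s.c = 1) (hl : s.Nl = 4) (hg : s.Ng = 0) : s.omega = -1 := by
  rw [s.omega_connected hc, hl, hg]; norm_num

/-- For a connected line set: ω ≥ 0 ⇔ 3·N_l + 2·N_γ ≤ 8. [cite: Volkov2020, §2.1 (journal p.7)] -/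
theorem omega_nonneg_iff_connected (hc : s.c = 1) : 0 ≤ s.omega ↔ 3 * s.Nl + 2 * s.Ng ≤ 8 := by
  rw [s.omega_connected hc]
  constructor
  · intro h
    have : (3 : ℚ) * s.Nl + 2 * s.Ng ≤ 8 := by linarith
    exact_mod_cast this
  · intro h
    have : (3 : ℚ) * s.Nl + 2 * s.Ng ≤ 8 := by exact_mod_cast h
    linarith

/-- No UV-divergent subgraph has four or more external lepton legs: connected and N_l ≥ 4 ⇒ ω < 0. [cite: Volkov2020, §2.1 (journal p.7)] -/
theorem omega_neg_of_four_leptons (hc : s.c = 1) (hl : 4 ≤ s.Nl) : s.omega < 0 := by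
  rw [s.omega_connected hc]
  have : (4 : ℚ) ≤ s.Nl := by exact_mod_cast hl
  have hg : (0 : ℚ) ≤ s.Ng := by exact_mod_cast Nat.zero_le _
  linarith

/-- With two external lepton legs (connected): ω ≥ 0 ⇔ N_γ ≤ 1 — a UV-divergent subgraph on the lepton path is a lepton SELF-ENERGY (N_γ = 0,
ω = ½) or VERTEXLIKE (N_γ = 1, ω = 0), nothing else; this is the dichotomy every 2020–2024 construction of Volkov's uses for graphs without
lepton loops. [cite: Volkov2020, §2.1 and §3.2 fn 24 (journal p.7, p.14)] -/
theorem omega_two_leptons (hc : s.c = 1) (hl : s.Nl = 2) : 0 ≤ s.omega ↔ s.Ng ≤ 1 := by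
  rw [s.omega_nonneg_iff_connected hc, hl]
  omega

/-- With no external lepton legs (connected; in QED such an s contains closed lepton loops): ω ≥ 0 ⇔ N_γ ≤ 4 — photon self-energy (2),
light-by-light (4), and the signatures N_γ ∈ {0, 1, 3} that Furry's theorem / the absence of vacuum and tadpole parts exclude ("odd lepton
loops are forbidden", [Volkov2024] fn 2). [cite: Volkov2020, §2.1 (journal p.7)] -/
theorem omega_no_leptons (hc : s.c = 1) (hl : s.Nl = 0) : 0 ≤ s.omega ↔ s.Ng ≤ 4 := by
  rw [s.omega_nonneg_iff_connected hc, hl]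
  omega

end QEDCounts

/-- A worked instance (the model is inhabited with the printed two-loop numbers): the crossed two-photon VERTEX graph of [Volkov2020]'s Appendix
(Fig. 2: five vertices, four internal lepton lines 1–4, two photon lines 5–6, external legs = 2 leptons + 1 photon) as a whole has Loop = 2 and
ω = 0 (vertexlike, logarithmic overall divergence). [cite: Volkov2020, Appendix (journal p.19)] -/
def crossedTwoLoopVertex : QEDCounts where
  V := 5
  El := 4
  Eg := 2
  Nl := 2
  Ng := 1
  c := 1
  hand_l := by decide
  hand_g := by decide
  loops_nonneg := by decide

/-- Its cyclomatic number is 2 and its ω is 0. [cite: Volkov2020, Appendix (journal p.19)] -/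
theorem crossedTwoLoopVertex_omega : crossedTwoLoopVertex.loops = 2 ∧ crossedTwoLoopVertex.omega = 0 := by
  constructor
  · unfold QEDCounts.loops crossedTwoLoopVertex; norm_num
  · exact crossedTwoLoopVertex.omega_vertex rfl rfl rfl

/-! ## The integer Speer exponent d(s) = ⌈−ω(s)⌉ of eq. (1.5) in closed form (Lemma 3.3 / proof of Lemma 3.5)

(Appended 2026-08-23 by seat V3b gen 7 for `tropical/view/V3-VOLKOV-DEGREES.md` §B.26: the cell's T2-COMPATIBILITY v1 DRAFT r8 L22 defines a
«block degree» λ(F) := |F| − 2L(F) − ⌊N_f(F)/2⌋ and observes λ(F) = ⌈−ω(F)/2⌉ with ITS ω(F) = 4 − (3/2)E_f − E_g = 2·ω_here (`omega_connected`)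
as an «identity, 6 877/6 877» over a census; the identity is PRINTED — it is the first bullet of the proof of Lemma 3.5 — and holds for every
line set.) VERBATIM: §1 eq. (1.5) (journal p.3; tex l.81–91) "|R(z,p)| ≤ C(p)·(z_{j₁})^{d₁}(z_{j₂}/z_{j₁})^{d₂}⋯(z_{j_L}/z_{j_{L−1}})^{d_L}/(z₁⋯z_L),
… d_l = ⌈−ω({j_l, j_{l+1}, …, j_L})⌉, … by ⌈x⌉ we denote the minimum integer y ≥ x. This estimation immediately leads to absolute convergence of
(1.2) for the given case [footnote: … taking into account that d_j > 0 …]"; §1 (journal p.5; tex l.119) "in contrast to the known case with fixed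
ε > 0 where all degrees are integer"; Lemma 3.3 (journal p.11; tex l.327–331) "|K(z)| ≤ C·∏_{l=1}^{L} t_l^{|s^{[l]}| − 2·Loop(s^{[l]}) − |P[s^{[l]}]|}
/(z₁…z_L)"; proof of Lemma 3.5 (journal p.13; tex l.421–426) "The power of t_l is constituted of the following terms: ⌈−ω(s^{[l]})⌉ +
⌊|Lept(s^{[l]})|/2⌋ − |P[s^{[l]}]| (Lemma 3.3; …)". -/

namespace QEDCounts

variable (s : QEDCounts)

/-- d(s) = ⌈−ω(s)⌉, the integer exponent of the Speer-type bound (1.5), IN CLOSED FORM, AS PRINTED in the proof of Lemma 3.5 (the power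
|s| − 2·Loop(s) − |P[s]| of Lemma 3.3 written as ⌈−ω(s)⌉ + ⌊|Lept(s)|/2⌋ − |P[s]|): for EVERY line set s, ⌈−ω(s)⌉ = |s| − 2·Loop(s) − ⌊|Lept(s)|/2⌋
(Loop(s) = |s| − V + c the cyclomatic number, ⌊·⌋ = integer part; |Lept(s)| = the number of lepton LINES in s).
[cite: Volkov2020, §1 eq. (1.5) (journal p.3; tex l.89); §3.1 Lemma 3.3 and §3.2 proof of Lemma 3.5 (journal p.11–13; tex l.327–331, l.421–426)] -/
theorem speer_d_eq : ⌈-s.omega⌉ = ((s.El : ℤ) + s.Eg) - 2 * (((s.El : ℤ) + s.Eg + s.c) - s.V) - ((s.El / 2 : ℕ) : ℤ) := by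
  have hdm0 : 2 * (s.El / 2) + s.El % 2 = s.El := Nat.div_add_mod s.El 2
  have hr : s.El % 2 < 2 := Nat.mod_lt _ (by norm_num)
  generalize s.El / 2 = q at hdm0 ⊢
  generalize s.El % 2 = r at hdm0 hr
  have hdm : (2 * q + r : ℚ) = (s.El : ℚ) := by exact_mod_cast hdm0
  have hr' : (r : ℚ) ≤ 1 := by exact_mod_cast Nat.lt_succ_iff.mp hr
  have hr0 : (0 : ℚ) ≤ (r : ℚ) := by positivity
  rw [Int.ceil_eq_iff]
  push_cast
  unfold omega loops
  constructor <;> linarith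

/-- In the cyclomatic form used by the cell's T2 seat: with L(s) := Loop(s), d(s) = |s| − 2L(s) − ⌊|Lept(s)|/2⌋ and, for CONNECTED s, the
doubled degree 2ω(s) = 4 − (3/2)N_lepton − N_photon (`omega_connected`), so d(s) = ⌈−(2ω(s))/2⌉ — T2-COMPATIBILITY L22's λ(F) = ⌈−ω_T2(F)/2⌉
is eq. (1.5)'s d. [cite: Volkov2020, §1 eq. (1.5), §2.1, §3.2 proof of Lemma 3.5 (journal p.3, 7, 13)] -/
theorem speer_d_eq_loops : ((⌈-s.omega⌉ : ℤ) : ℚ) = ((s.El : ℚ) + s.Eg) - 2 * s.loops - ((s.El / 2 : ℕ) : ℚ) ∧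
    ⌈-s.omega⌉ = ⌈-(2 * s.omega) / 2⌉ := by
  constructor
  · rw [speer_d_eq]
    generalize s.El / 2 = q
    unfold loops
    push_cast
    ring
  · congr 1; ring

/-- d(s) ≤ 0 exactly when ω(s) ≥ 0 — for connected s exactly when 3N_lepton + 2N_photon ≤ 8 (`omega_nonneg_iff_connected`: the self-energy,
vertex, photon self-energy and light-by-light sets): the footnote to (1.5) needs «d_j > 0», which is why the paper's scope excludes
UV-divergent subgraphs. [cite: Volkov2020, §1 eq. (1.5) with its footnote, §2.1 (journal p.3–4, 7)] -/
theorem speer_d_nonpos_iff : ⌈-s.omega⌉ ≤ 0 ↔ 0 ≤ s.omega := by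
  rw [Int.ceil_le]
  push_cast
  constructor <;> intro h <;> linarith

/-- The four UV-divergent connected types (ω = ½, 0, 1, 0) have d = ⌈−ω⌉ = 0, 0, −1, 0 ≤ 0: no decay from (1.5) on those Hepp levels.
[cite: Volkov2020, §1 eq. (1.5), §2.1 (journal p.3, 7)] -/
theorem speer_d_uv_types (hc : s.c = 1) :
    (s.Nl = 2 → s.Ng = 0 → ⌈-s.omega⌉ = 0) ∧ (s.Nl = 2 → s.Ng = 1 → ⌈-s.omega⌉ = 0) ∧
    (s.Nl = 0 → s.Ng = 2 → ⌈-s.omega⌉ = -1) ∧ (s.Nl = 0 → s.Ng = 4 → ⌈-s.omega⌉ = 0) := by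
  refine ⟨fun hl hg => ?_, fun hl hg => ?_, fun hl hg => ?_, fun hl hg => ?_⟩
  · rw [s.omega_self_energy hc hl hg]; norm_num
  · rw [s.omega_vertex hc hl hg]; norm_num
  · rw [s.omega_photon_self_energy hc hl hg]; norm_num
  · rw [s.omega_light_by_light hc hl hg]; norm_num

end QEDCounts

/-- On the Appendix's crossed two-loop vertex graph as a whole: d = ⌈−0⌉ = 0 = |s| − 2·Loop − ⌊|Lept|/2⌋ = 6 − 4 − 2. [cite: Volkov2020, Appendix (journal p.19)] -/
theorem crossedTwoLoopVertex_speer_d : ⌈-crossedTwoLoopVertex.omega⌉ = 0 := by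
  rw [QEDCounts.speer_d_eq]; rfl

end Literature.MathematicalPhysics.QuantumFieldTheory.Volkov2020
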